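import Mathlib
import Summits.CriticalPhenomena.CardyFormulaZ2.Theorems.CardySelfRefinementDefs
import Summits.CriticalPhenomena.CardyFormulaZ2.Theorems.CardySelfRefinementTrivialSectorRateStubFourArmAboveOneEndpoint
import Literature.Probability.Percolation.FourArmGarbanShift
import Literature.Probability.Percolation.FourArmGarbanMonotone
import Literature.Probability.Percolation.FourArmGarbanDocking
import Literature.Probability.Percolation.ZdFiveArmMonotone
import Literature.Probability.Percolation.SelfRefinementMeasure
import HarnessLib

/-!
# Stub `stub_sixArmDecay` of line `far-field-is-a-quarter-turn` (crux `TrivialSectorRate`,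
stmt-CriticalPhenomena-10266): STRUCTURE OF THE SIX-ARM EVENT `sixArmThreeClustersAt`

The six-arm event of the line (`Theorems/CardySelfRefinementDefs.lean`, sub-namespace `FarField`) is
rendered in cluster form: three open crossings of the translated square annulus `c + A_{m,n}`,
pairwise NOT joined by an open path of `c + A_{m,n}`.  This file records its elementary structure,
the part of the stub that does not depend on arm-exponent theory for the dependent model `M_k`:

* `sixArmThreeClustersAt_subset_fourArmTwoClustersAt` — **six arms contain four arms** (forget the
  third crossing; registered helper of the stub);
* `relabel_shift_mem_sixArmThreeClustersAt`, `sixArmThreeClustersAt_eq_preimage` — transport by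
  translations: the event around `c` is the translate of the event around the origin;
* `mem_zdFiveArmClusters_of_mem_sixArmThreeClustersAt_zero`,
  `mem_preimage_zdFiveArmClusters_of_mem_sixArmThreeClustersAt` — **six arms contain the tree's
  five-arm event `zdFiveArmClusters`** (`ZdFourArmFromFiveArm.lean`, cluster form `σ₅ = (o c o c o)`)
  on lattice configurations: the open crossings are lattice walks, and two of them sharing an edge
  would join their inner endpoints;
* `mem_sixArmThreeClustersAt_mono`, `real_sixArmThreeClustersAt_mono` — monotonicity under
  shrinking the annulus (first-exit / last-entry surgery of the three crossings, as for
  `mem_fourArmTwoClusters_mono`), on lattice configurations and under every `M_k(ρ,c)`;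
* `real_sixArmThreeClustersAt_le_zdFiveArm` — `M_k(ρ,c)(six arms around c) ≤ M_k(ρ,c)(five arms
  around c)`, and at the endpoint `γ 1 = (0, ½)` of an admissible path (critical bond-`ℤ²`,
  `M_apply_one_eq_bondPercolation`) `≤ P_{1/2}(zdFiveArmClusters m n) ≤ π₄(m,n) · π₁(m,n)`
  (translation invariance and the tree's Reimer step `real_zdFiveArmClusters_le`).

What is NOT here (and not in the tree): the five-arm UPPER bound `P(five arms) ≤ C (m/n)²`
(Kesten–Sidoravicius–Zhang; Nolin 2008 Thm. 23 (ii), upper half: uniqueness of separated five-arm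
points + arm separation) and the price `(m/n)^δ` of the sixth arm, for `M_k` along the path or even
for bond-`ℤ²` at `½`; see `…TrivialSectorRateStubSixArmDecayReduction.lean` for the exact missing
inputs.

Target file:
`Summits/CriticalPhenomena/CardyFormulaZ2/Theorems/CardySelfRefinementTrivialSectorRateStubSixArmDecayClusters.lean`.
-/

noncomputable section


namespace Summit.CriticalPhenomena.CardyFormulaZ2.Theorems.CardySelfRefinement.FarField

open Set MeasureTheory
open Literature.Probability.LatticeModels Literature.Probability.Percolation
open Literature.Probability.Percolation.QuadCrossing
open Summit.CriticalPhenomena.CardyFormulaZ2.Theses.CardySelfRefinement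

/-! ### Six arms contain four arms -/

/-- **Six arms contain four arms** (registered helper of the stub `stub_sixArmDecay`): three
pairwise-separated open crossings of `c + A_{m,n}` contain two separated ones — keep the crossings
`0` and `1`. -/
theorem sixArmThreeClustersAt_subset_fourArmTwoClustersAt (c : Site 2) (m n : ℕ) :
    sixArmThreeClustersAt c m n ⊆ fourArmTwoClustersAt c m n := by
  rintro ω ⟨x, y, hxy, hpair⟩
  exact ⟨x 0, (hxy 0).1, x 1, (hxy 1).1, y 0, (hxy 0).2.1, y 1, (hxy 1).2.1, (hxy 0).2.2,
    (hxy 1).2.2, hpair (show (0 : Fin 3) ≠ 1 by decide)⟩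

/-- Measure form: `μ(six arms around c) ≤ μ(four arms around c)` for every finite measure. -/
theorem real_sixArmThreeClustersAt_le_fourArm (μ : Measure (BondConfig (Site 2))) [IsFiniteMeasure μ]
    (c : Site 2) (m n : ℕ) :
    μ.real (sixArmThreeClustersAt c m n) ≤ μ.real (fourArmTwoClustersAt c m n) :=
  measureReal_mono (sixArmThreeClustersAt_subset_fourArmTwoClustersAt c m n) (measure_ne_top _ _)

/-! ### Translation -/

-- adapted from Literature/Probability/Percolation/FourArmGarbanShift.lean
-- (`relabel_shift_mem_fourArmTwoClustersAt`, `fourArmTwoClustersAt_eq_preimage`), three crossings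
/-- **Transport by translation**: shifting the configuration by `v` carries the six arms around `c`
to six arms around `c + v`. -/
theorem relabel_shift_mem_sixArmThreeClustersAt {c v : Site 2} {m n : ℕ} {ω : BondConfig (Site 2)}
    (h : ω ∈ sixArmThreeClustersAt c m n) :
    BondConfig.relabel (sym2Equiv (Site.shift v)) ω ∈ sixArmThreeClustersAt (c + v) m n := by
  obtain ⟨x, y, hxy, hpair⟩ := h
  have hsub : ∀ z : Site 2, Site.shift v z - (c + v) = z - c := fun z => by
    show z + v - (c + v) = z - c
    abel
  refine ⟨fun j => Site.shift v (x j), fun j => Site.shift v (y j), fun j => ⟨?_, ?_, ?_⟩,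
    fun i j hij => ?_⟩
  · rw [hsub]; exact (hxy j).1
  · rw [hsub]; exact (hxy j).2.1
  · have := relabel_mem_openConnIn (Site.shift v) (hxy j).2.2
    rwa [image_shift_image_add] at this
  · intro h
    apply hpair hij
    have h' := relabel_mem_openConnIn (Site.shift (-v)) h
    rw [image_shift_image_add, add_neg_cancel_right] at h'
    have hω : BondConfig.relabel (sym2Equiv (Site.shift (-v)))
        (BondConfig.relabel (sym2Equiv (Site.shift v)) ω) = ω := by
      simpa using relabel_shift_neg_relabel_shift v ω
    have hx : Site.shift (-v) (Site.shift v (x i)) = x i := by simp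
    have hx' : Site.shift (-v) (Site.shift v (x j)) = x j := by simp
    rwa [hω, hx, hx'] at h'

/-- **The event around `c` is the translate of the event around the origin**: `ω` has six arms
around `c` iff `ω - c` has six arms around `0`. -/
theorem sixArmThreeClustersAt_eq_preimage (c : Site 2) (m n : ℕ) :
    sixArmThreeClustersAt c m n =
      BondConfig.relabel (sym2Equiv (Site.shift (-c))) ⁻¹' sixArmThreeClustersAt 0 m n := by
  ext ω
  rw [mem_preimage]
  constructor
  · intro h
    have := relabel_shift_mem_sixArmThreeClustersAt (v := -c) h
    rwa [add_neg_cancel] at this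
  · intro h
    have := relabel_shift_mem_sixArmThreeClustersAt (v := c) h
    rw [zero_add] at this
    have hω : BondConfig.relabel (sym2Equiv (Site.shift c))
        (BondConfig.relabel (sym2Equiv (Site.shift (-c))) ω) = ω := by
      simpa using relabel_shift_neg_relabel_shift (-c) ω
    rwa [hω] at this

/-- The annulus translated by `0`. -/
theorem image_add_zero_sqAnnulus (m n : ℕ) : ((· + (0 : Site 2)) '' sqAnnulus m n) = sqAnnulus m n := by
  rw [show (fun x : Site 2 => x + 0) = id from funext fun x => add_zero x, Set.image_id]

/-- The six-arm event around the origin, with the translation by `0` removed. -/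
theorem mem_sixArmThreeClustersAt_zero_iff {m n : ℕ} {ω : BondConfig (Site 2)} :
    ω ∈ sixArmThreeClustersAt 0 m n ↔ ∃ x y : Fin 3 → Site 2,
      (∀ j, x j ∈ siteSphere m ∧ y j ∈ siteSphere n ∧ ω ∈ openConnIn (sqAnnulus m n) (x j) (y j)) ∧
      Pairwise fun i j => ω ∉ openConnIn (sqAnnulus m n) (x i) (x j) := by
  simp only [sixArmThreeClustersAt, sub_zero, image_add_zero_sqAnnulus, mem_setOf_eq]

/-! ### Six arms contain the five-arm event of the tree -/

/-- **Six arms contain five arms** (lattice configurations, around the origin): the three open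
crossings are open lattice walks (`exists_walk_of_mem_openConnIn`); an edge common to two of them
would join their inner endpoints inside the annulus, so they are pairwise edge-disjoint; forgetting
the separation of the third crossing from the first two leaves exactly the tree's cluster-form
five-arm event `zdFiveArmClusters m n` (`σ₅ = (o c o c o)`). -/
theorem mem_zdFiveArmClusters_of_mem_sixArmThreeClustersAt_zero {m n : ℕ} {ω : BondConfig (Site 2)}
    (hω : ω ⊆ (zdGraph 2).edgeSet) (h : ω ∈ sixArmThreeClustersAt 0 m n) :
    ω ∈ zdFiveArmClusters m n := by
  classical
  rw [mem_sixArmThreeClustersAt_zero_iff] at h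
  obtain ⟨x, y, hxy, hpair⟩ := h
  obtain ⟨W₀, hs₀, he₀⟩ := exists_walk_of_mem_openConnIn hω (hxy 0).2.2
  obtain ⟨W₁, hs₁, he₁⟩ := exists_walk_of_mem_openConnIn hω (hxy 1).2.2
  obtain ⟨W₂, hs₂, he₂⟩ := exists_walk_of_mem_openConnIn hω (hxy 2).2.2
  -- an edge common to two of the walks would join their inner endpoints
  have hdisj : ∀ {i j : Fin 3} (Wi : (zdGraph 2).Walk (x i) (y i)) (Wj : (zdGraph 2).Walk (x j) (y j)),
      i ≠ j → (∀ z ∈ Wi.support, z ∈ sqAnnulus m n) → (∀ e ∈ Wi.edges, e ∈ ω) →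
      (∀ z ∈ Wj.support, z ∈ sqAnnulus m n) → (∀ e ∈ Wj.edges, e ∈ ω) →
      ∀ e ∈ Wi.edges, e ∉ Wj.edges := by
    intro i j Wi Wj hij hsi hei hsj hej e hi hj
    induction e using Sym2.ind with
    | h a b =>
      have h1 : ω ∈ openConnIn (sqAnnulus m n) (x i) a :=
        mem_openConnIn_of_mem_support Wi hsi hei (Wi.fst_mem_support_of_mem_edges hi)
      have h2 : ω ∈ openConnIn (sqAnnulus m n) (x j) a :=
        mem_openConnIn_of_mem_support Wj hsj hej (Wj.fst_mem_support_of_mem_edges hj)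
      rw [openConnIn_comm] at h2
      exact hpair hij (PlanarDuality.openConnIn_trans h1 h2)
  exact ⟨x 0, x 1, x 2, y 0, y 1, y 2, W₀, W₁, W₂, (hxy 0).1, (hxy 1).1, (hxy 2).1, (hxy 0).2.1,
    (hxy 1).2.1, (hxy 2).2.1, hs₀, hs₁, hs₂, he₀, he₁, he₂,
    hdisj W₀ W₂ (by decide) hs₀ he₀ hs₂ he₂, hdisj W₁ W₂ (by decide) hs₁ he₁ hs₂ he₂,
    hpair (show (0 : Fin 3) ≠ 1 by decide)⟩

/-- **Six arms around `c` contain five arms around `c`** (lattice configurations): `ω - c` lies in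
the tree's five-arm event. -/
theorem mem_preimage_zdFiveArmClusters_of_mem_sixArmThreeClustersAt {c : Site 2} {m n : ℕ}
    {ω : BondConfig (Site 2)} (hω : ω ⊆ (zdGraph 2).edgeSet) (h : ω ∈ sixArmThreeClustersAt c m n) :
    BondConfig.relabel (sym2Equiv (Site.shift (-c))) ω ∈ zdFiveArmClusters m n := by
  rw [sixArmThreeClustersAt_eq_preimage] at h
  exact mem_zdFiveArmClusters_of_mem_sixArmThreeClustersAt_zero (relabel_shift_subset_edgeSet (-c) hω) h

/-! ### Monotonicity in the radii -/

-- adapted from Literature/Probability/Percolation/FourArmGarbanMonotone.lean (`mem_fourArmTwoClusters_mono`)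
/-- **The six-arm event is monotone under shrinking the annulus** (lattice configurations, around
the origin): for `m ≤ m' ≤ n' ≤ n`, restrict each crossing of `A_{m,n}` to a crossing of
`A_{m',n'}` (last entry, first exit); a junction of two restricted crossings inside
`A_{m',n'} ⊆ A_{m,n}`, together with the discarded initial pieces, would join the original inner
endpoints in `A_{m,n}`. -/
theorem mem_sixArmThreeClustersAt_zero_mono {m m' n' n : ℕ} (hmm' : m ≤ m') (hm'n' : m' ≤ n')
    (hn'n : n' ≤ n) {ω : BondConfig (Site 2)} (hω : ω ⊆ (zdGraph 2).edgeSet)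
    (h : ω ∈ sixArmThreeClustersAt 0 m n) : ω ∈ sixArmThreeClustersAt 0 m' n' := by
  rw [mem_sixArmThreeClustersAt_zero_iff] at h ⊢
  obtain ⟨x, y, hxy, hpair⟩ := h
  have key : ∀ j, ∃ x' y' : Site 2, x' ∈ siteSphere m' ∧ y' ∈ siteSphere n' ∧
      ω ∈ openConnIn (sqAnnulus m' n') x' y' ∧ ω ∈ openConnIn (sqAnnulus m n) (x j) x' := by
    intro j
    obtain ⟨hx, hy, hj⟩ := hxy j
    obtain ⟨x', hx', g, jn⟩ :=
      exists_openConnIn_sqAnnulus_of_le_left hmm' (hm'n'.trans hn'n) hω hx hy hj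
    obtain ⟨y', hy', g'⟩ := exists_openConnIn_sqAnnulus_of_le_right hm'n' hn'n hω hx' hy g
    exact ⟨x', y', hx', hy', g', jn⟩
  choose x' y' hx' hy' hg hj using key
  refine ⟨x', y', fun j => ⟨hx' j, hy' j, hg j⟩, fun i j hij hc => hpair hij ?_⟩
  have hc' : ω ∈ openConnIn (sqAnnulus m n) (x' i) (x' j) :=
    openConnIn_mono (sqAnnulus_mono hmm' hn'n) _ _ hc
  have j₂ := hj j
  rw [openConnIn_comm] at j₂
  exact PlanarDuality.openConnIn_trans (PlanarDuality.openConnIn_trans (hj i) hc') j₂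

/-- **The six-arm event around any centre is monotone under shrinking the annulus** (lattice
configurations; translate to the origin). -/
theorem mem_sixArmThreeClustersAt_mono {c : Site 2} {m m' n' n : ℕ} (hmm' : m ≤ m') (hm'n' : m' ≤ n')
    (hn'n : n' ≤ n) {ω : BondConfig (Site 2)} (hω : ω ⊆ (zdGraph 2).edgeSet)
    (h : ω ∈ sixArmThreeClustersAt c m n) : ω ∈ sixArmThreeClustersAt c m' n' := by
  rw [sixArmThreeClustersAt_eq_preimage, mem_preimage] at h ⊢
  exact mem_sixArmThreeClustersAt_zero_mono hmm' hm'n' hn'n (relabel_shift_subset_edgeSet (-c) hω) h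

/-- **`M_k(ρ,c₀)(six arms around c across A_{m,n}) ≤ M_k(ρ,c₀)(six arms around c across A_{m',n'})`
for `m ≤ m' ≤ n' ≤ n`** (`M_k` is carried by lattice configurations,
`selfRefinementMeasure_ae_subset_edgeSet`). -/
theorem real_sixArmThreeClustersAt_mono (k : ℕ) (ρ c₀ : ℝ) (c : Site 2) {m m' n' n : ℕ} (hmm' : m ≤ m')
    (hm'n' : m' ≤ n') (hn'n : n' ≤ n) :
    (M k ρ c₀).real (sixArmThreeClustersAt c m n) ≤ (M k ρ c₀).real (sixArmThreeClustersAt c m' n') := by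
  refine ENNReal.toReal_mono (measure_ne_top _ _) (measure_mono_ae ?_)
  have hae : ∀ᵐ ω ∂(M k ρ c₀), ω ⊆ (zdGraph 2).edgeSet := selfRefinementMeasure_ae_subset_edgeSet k ρ c₀
  filter_upwards [hae] with ω hω h6
  exact mem_sixArmThreeClustersAt_mono hmm' hm'n' hn'n hω h6

/-! ### Six arms under `M_k` and at the endpoint `s = 1` -/

/-- **`M_k(ρ,c₀)(six arms around c) ≤ M_k(ρ,c₀)(ω - c has five arms)`**: the six-arm probability of
the self-refinement model is at most that of the tree's five-arm event, recentred. -/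
theorem real_sixArmThreeClustersAt_le_zdFiveArm (k : ℕ) (ρ c₀ : ℝ) (c : Site 2) (m n : ℕ) :
    (M k ρ c₀).real (sixArmThreeClustersAt c m n) ≤
      (M k ρ c₀).real (BondConfig.relabel (sym2Equiv (Site.shift (-c))) ⁻¹' zdFiveArmClusters m n) := by
  refine ENNReal.toReal_mono (measure_ne_top _ _) (measure_mono_ae ?_)
  have hae : ∀ᵐ ω ∂(M k ρ c₀), ω ⊆ (zdGraph 2).edgeSet := selfRefinementMeasure_ae_subset_edgeSet k ρ c₀
  filter_upwards [hae] with ω hω h6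
  exact mem_preimage_zdFiveArmClusters_of_mem_sixArmThreeClustersAt hω h6

/-- **At the endpoint `γ 1 = (0, ½)`** of an admissible path the model is critical bond-`ℤ²`
(`M_apply_one_eq_bondPercolation`) and, by translation invariance of `P_{1/2}`
(`bondPercolation_real_preimage_shift`), the six-arm probability around every centre is at most the
critical five-arm probability `P_{1/2}(zdFiveArmClusters m n)` — whose upper bound `C (m/n)²`
(Kesten–Sidoravicius–Zhang; Nolin 2008, Thm. 23 (ii), upper half) is not in the tree. -/
theorem real_sixArmThreeClustersAt_apply_one_le {k : ℕ} {γ : unitInterval → ℝ × ℝ} (hγ : PathOK k γ)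
    (c : Site 2) (m n : ℕ) :
    (M k (γ 1).1 (γ 1).2).real (sixArmThreeClustersAt c m n) ≤
      (bondPercolation (zdGraph 2) half).real (zdFiveArmClusters m n) := by
  have h := real_sixArmThreeClustersAt_le_zdFiveArm k (γ 1).1 (γ 1).2 c m n
  rw [M_apply_one_eq_bondPercolation hγ, bondPercolation_real_preimage_shift] at h
  rwa [M_apply_one_eq_bondPercolation hγ]

/-- **At the endpoint, six arms cost at most `π₄(m,n) · π₁(m,n)`** (the tree's Reimer step
`real_zdFiveArmClusters_le`: `𝒜₅ ⊆ 𝒜₄ □ 𝒜₁`), hence at most `C (m/n)^{1+ε+α}` by `fourArm_bound` and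
the one-arm bound — exponent `> 1`, not the `> 2` demanded by `SixArmDecayAlong`. -/
theorem real_sixArmThreeClustersAt_apply_one_le_mul {k : ℕ} {γ : unitInterval → ℝ × ℝ} (hγ : PathOK k γ)
    (c : Site 2) (m n : ℕ) :
    (M k (γ 1).1 (γ 1).2).real (sixArmThreeClustersAt c m n) ≤
      (bondPercolation (zdGraph 2) half).real (fourArmTwoClusters m n) *
        (bondPercolation (zdGraph 2) half).real (sqAnnulusOpenCrossing m n) :=
  (real_sixArmThreeClustersAt_apply_one_le hγ c m n).trans (real_zdFiveArmClusters_le half m n)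

end Summit.CriticalPhenomena.CardyFormulaZ2.Theorems.CardySelfRefinement.FarField

end
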